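import Literature.AlgebraicGeometry.Milne1999.ProductPolarizationClass
import Literature.AlgebraicGeometry.HodgeTheory.HardLefschetzProductsFactors
import HarnessLib

/-!
# Milne's product divisor class restricts to its factors, and is a polarization class iff the factors are
# (Milne 1999 §1 p. 643, Birkenhake–Lange §5.3 — the converse direction on `A × B`, `A^{r+1}`, `⨁ᵢ Aᵢ`)

Family `hodge`, lane `lit-hodgefound` (Track 2 foundations library), layer `Literature/AlgebraicGeometry/Milne1999`,
namespace `Literature.AlgebraicGeometry.Milne1999`; prover seat `lit-hodgefound-p21` (generation 36, row g36-#5), the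
abelian-variety sequel of `Milne1999/ProductPolarizationClass` (g36-#1: `pr_A^* h_A + pr_B^* h_B`, `Σᵢ prᵢ^* h`,
`Σᵢ πᵢ^* hᵢ` ARE polarization classes when the `hᵢ` are) and of `HodgeTheory/HardLefschetzProductsFactors` (g36-#4:
on smooth projective `Y × Z`, `pr_Y^* η + pr_Z^* η'` is hard Lefschetz / a polarization class IFF `η` and `η'` are).
THEOREMS ONLY (no definition, no named fact, no instance; D-0026 net debt `0`).

## Sources, VERBATIM

* J. S. Milne, *Lefschetz classes on abelian varieties*, Duke Math. J. **96** (1999) [Milne1999LefschetzClasses], §1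
  p. 643: «Let `A₁, …, A_s` be abelian varieties, and let `A = A₁ × ⋯ × A_s`. If `Dᵢ` is an ample divisor on `Aᵢ` for
  each `i`, then `D = Σᵢ A₁ × ⋯ × A_{i-1} × Dᵢ × A_{i+1} × ⋯ × A_s` is an ample divisor on `A`».
* Ch. Birkenhake, H. Lange, *Complex Abelian Varieties* (1992) [LangeBirkenhake1992], §5.3 (products of polarized
  abelian varieties: `p₁^* L₁ ⊗ p₂^* L₂` restricts to `Lᵢ` on `A₁ × {0}`, `{0} × A₂`), Lemma 1.7.4.
* H. Lange, *Abelian Varieties over the Complex Numbers* (2023) [Lange2023AbelianVarietiesC], Cor. 2.4.26 (`ι₁ = (𝟙, 0)`,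
  `ι₂ = (0, 𝟙)`, `ιᵢ ≫ prⱼ = δᵢⱼ`).
* D. Mumford, *Abelian Varieties* (1970) [MumfordAV1970], §19 (`Hom(C, A × B) = Hom(C, A) ⊕ Hom(C, B)`; isogenies).
* T. Harima et al., *The Lefschetz Properties*, LNM 2080 (2013) [HarimaEtAl2013], Thm. 3.34 and Prop. 3.67 (the strong
  Lefschetz property of a tensor product and of its factors — the mechanism of `HardLefschetzProductsFactors`).

## WHAT IS PROVED (`A B : AbelianVariety ℂ`, `h_A ∈ H²(A(ℂ); ℂ)`, `h_B ∈ H²(B(ℂ); ℂ)`, `D = prodPolarizationClass A B h_A h_B`)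

* §1 RESTRICTION: for every homomorphism `ι : A ⟶ A × B` with `ι ≫ pr_A = 𝟙`, `ι ≫ pr_B = 0`,
  **`complexBetti_map_prodPolarizationClass_of_comp_fst_eq_id`** (`ι^* D = h_A`); symmetrically `ι^* D = h_B` for
  `ι ≫ pr_B = 𝟙`, `ι ≫ pr_A = 0`; the instances `ι₁ = (𝟙, 0)`, `ι₂ = (0, 𝟙)` (`AbelianVariety.prodLift`) and
  `biprod.inl ≫ (A ⊞ B ≅ A × B)`, `biprod.inr ≫ (A ⊞ B ≅ A × B)` (via the tree's
  `HodgeTheory.complexBetti_map_zero_hom_apply`: `0^* = 0` in positive degree); `prodPolarizationClass_inj` (`D`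
  determines `h_A` and `h_B`).
* §2 TRANSPORT: along a homomorphism `f : P ⟶ Q` with a two-sided inverse, `f^* κ` is hard Lefschetz in dimension
  `dim P` / a polarization class of `P` iff `κ` is so for `Q` (`hasHardLefschetzProperty_map_iff_of_comp_eq_id`,
  `isPolarizationClass_map_iff_of_comp_eq_id`; isogeny transport of the tree in both directions).
* §3 `A × B`: **`hasHardLefschetzProperty_prodPolarizationClass_iff`** (`D` hard Lefschetz in dimension `dim (A × B)` iff
  `h_A`, `h_B` are in dimensions `dim A`, `dim B`), **`isPolarizationClass_prodPolarizationClass_iff`** (`D` is a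
  polarization class of `A × B` iff `h_A`, `h_B` are polarization classes of `A`, `B`), and the two projections
  `IsPolarizationClass.left/right_of_prodPolarizationClass`.
* §4 `A^{r+1}`: **`hasHardLefschetzProperty_powPolarizationClass_iff`**, **`isPolarizationClass_powPolarizationClass_iff`**
  (`Σᵢ prᵢ^* h` is hard Lefschetz / a polarization class of `A^{r+1}` iff `h` is one of `A`).
* §5 `⨁ᵢ Aᵢ`: **`hasHardLefschetzProperty_sumPolarizationClass_iff`**, **`isPolarizationClass_sumPolarizationClass_iff`**
  (`Σᵢ πᵢ^* hᵢ` is hard Lefschetz / a polarization class of `⨁_{i<n+1} Aᵢ` iff every `hᵢ` is one of `Aᵢ`).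

## SCOPE / NOT HERE

Ampleness of divisors is not discussed (only the three components of `IsPolarizationClass`); Milne's statement is
about ample divisors, of which the polarization-class property is the cohomological shadow used by the `Milne1999/`
files.

## References

* [Milne1999LefschetzClasses] J. S. Milne, Duke Math. J. 96 (1999), §1 p. 643.
* [LangeBirkenhake1992] Ch. Birkenhake, H. Lange, *Complex Abelian Varieties* (1992), §5.3, Lemma 1.7.4.
* [Lange2023AbelianVarietiesC] H. Lange, *Abelian Varieties over the Complex Numbers* (2023), Cor. 2.4.26.
* [MumfordAV1970] D. Mumford, *Abelian Varieties* (1970), §19.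
* [HarimaEtAl2013] T. Harima, T. Maeno, H. Morita, Y. Numata, A. Wachi, J. Watanabe, LNM 2080 (2013), Thm. 3.34, Prop. 3.67.
* [vanGeemen1994HodgeAV] B. van Geemen, LNM 1594 (1994), 3.6 (isogenies induce isomorphisms on `H•(·, ℚ)`).
-/

noncomputable section

open CategoryTheory CategoryTheory.Limits
open Literature.AlgebraicTopology.SingularHomology
open Literature.AlgebraicGeometry.HodgeTheory
open Literature.AlgebraicGeometry.Motives
open Literature.Geometry.Kaehler (lefschetzPow HasHardLefschetzProperty)

namespace Literature.AlgebraicGeometry.Milne1999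

/-! ### §1 `D = pr_A^* h_A + pr_B^* h_B` restricts to `h_A` on `A × {0}` and to `h_B` on `{0} × B` -/

section Restriction

variable (A B : AbelianVariety ℂ) {hA : complexBetti A.X 2} {hB : complexBetti B.X 2}

/-- `ι^* pr^* = (ι ≫ pr)^*` applied to a class (contravariance of `H*(–(ℂ); ℂ)` on homomorphisms). [folklore] -/
private theorem map_map_eq_map_comp {P Q R : AbelianVariety ℂ} (ι : P ⟶ Q) (p : Q ⟶ R) {k : ℕ} (c : complexBetti R.X k) :
    complexBetti.map ι.hom.hom.hom k (complexBetti.map p.hom.hom.hom k c) = complexBetti.map (ι ≫ p).hom.hom.hom k c := by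
  rw [complexBetti_map_comp_hom, ModuleCat.comp_apply]

/-- `(𝟙 P)^* c = c`. [folklore] -/
private theorem map_id_hom_apply {P : AbelianVariety ℂ} {k : ℕ} (c : complexBetti P.X k) :
    complexBetti.map (𝟙 P : P ⟶ P).hom.hom.hom k c = c := by
  change complexBetti.map (𝟙 P.X) k c = c
  rw [complexBetti.map_id]
  rfl

/-- **`ι^*(pr_A^* h_A + pr_B^* h_B) = h_A` for every homomorphism `ι : A ⟶ A × B` with `ι ≫ pr_A = 𝟙`,
`ι ≫ pr_B = 0`** (e.g. `ι₁ = (𝟙, 0)`): `ι^* pr_A^* = 𝟙`, and `ι^* pr_B^* = 0^* = 0` in positive degree.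
(Birkenhake–Lange: the product polarization restricts to `L₁` on `A₁ × {0}`.) [cite: LangeBirkenhake1992, §5.3]
[cite: Lange2023AbelianVarietiesC, Cor. 2.4.26] [cite: Milne1999LefschetzClasses, §1 p. 643] -/
theorem complexBetti_map_prodPolarizationClass_of_comp_fst_eq_id (ι : A ⟶ A.prod B)
    (h₁ : ι ≫ AbelianVariety.fst A B = 𝟙 A) (h₂ : ι ≫ AbelianVariety.snd A B = 0) :
    complexBetti.map ι.hom.hom.hom 2 (prodPolarizationClass A B hA hB) = hA := by
  rw [prodPolarizationClass_def, map_add, map_map_eq_map_comp, map_map_eq_map_comp, h₁, h₂, map_id_hom_apply,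
    complexBetti_map_zero_hom_apply two_ne_zero, add_zero]

/-- **`ι^*(pr_A^* h_A + pr_B^* h_B) = h_B` for every homomorphism `ι : B ⟶ A × B` with `ι ≫ pr_B = 𝟙`,
`ι ≫ pr_A = 0`** (e.g. `ι₂ = (0, 𝟙)`). [cite: LangeBirkenhake1992, §5.3] [cite: Lange2023AbelianVarietiesC, Cor. 2.4.26]
[cite: Milne1999LefschetzClasses, §1 p. 643] -/
theorem complexBetti_map_prodPolarizationClass_of_comp_snd_eq_id (ι : B ⟶ A.prod B)
    (h₁ : ι ≫ AbelianVariety.fst A B = 0) (h₂ : ι ≫ AbelianVariety.snd A B = 𝟙 B) :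
    complexBetti.map ι.hom.hom.hom 2 (prodPolarizationClass A B hA hB) = hB := by
  rw [prodPolarizationClass_def, map_add, map_map_eq_map_comp, map_map_eq_map_comp, h₁, h₂, map_id_hom_apply,
    complexBetti_map_zero_hom_apply two_ne_zero, zero_add]

/-- **`(𝟙, 0)^* D = h_A`** for `ι₁ = (𝟙, 0) : A ⟶ A × B` (`AbelianVariety.prodLift`). [cite: LangeBirkenhake1992, §5.3]
[cite: Lange2023AbelianVarietiesC, Cor. 2.4.26] -/
theorem complexBetti_map_prodLift_id_zero_prodPolarizationClass :
    complexBetti.map (AbelianVariety.prodLift (𝟙 A) (0 : A ⟶ B)).hom.hom.hom 2 (prodPolarizationClass A B hA hB) = hA :=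
  complexBetti_map_prodPolarizationClass_of_comp_fst_eq_id A B _ (AbelianVariety.prodLift_fst _ _)
    (AbelianVariety.prodLift_snd _ _)

/-- **`(0, 𝟙)^* D = h_B`** for `ι₂ = (0, 𝟙) : B ⟶ A × B`. [cite: LangeBirkenhake1992, §5.3]
[cite: Lange2023AbelianVarietiesC, Cor. 2.4.26] -/
theorem complexBetti_map_prodLift_zero_id_prodPolarizationClass :
    complexBetti.map (AbelianVariety.prodLift (0 : B ⟶ A) (𝟙 B)).hom.hom.hom 2 (prodPolarizationClass A B hA hB) = hB :=
  complexBetti_map_prodPolarizationClass_of_comp_snd_eq_id A B _ (AbelianVariety.prodLift_fst _ _)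
    (AbelianVariety.prodLift_snd _ _)

/-- The same for the inclusion `biprod.inl ≫ (A ⊞ B ≅ A × B)` of the first biproduct summand (the tree's `inlHom` of
`HOneOfProductEndomorphismBlocks`). [cite: Lange2023AbelianVarietiesC, Cor. 2.4.26] [cite: LangeBirkenhake1992, §5.3] -/
theorem complexBetti_map_biprodInl_prodPolarizationClass :
    complexBetti.map (biprod.inl ≫ (AbelianVariety.biprodIsoProd A B).hom).hom.hom.hom 2
      (prodPolarizationClass A B hA hB) = hA :=
  complexBetti_map_prodPolarizationClass_of_comp_fst_eq_id A B _
    (by rw [Category.assoc, AbelianVariety.biprodIsoProd_hom_fst, biprod.inl_fst])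
    (by rw [Category.assoc, AbelianVariety.biprodIsoProd_hom_snd, biprod.inl_snd])

/-- The same for the inclusion `biprod.inr ≫ (A ⊞ B ≅ A × B)` of the second biproduct summand (`inrHom`).
[cite: Lange2023AbelianVarietiesC, Cor. 2.4.26] [cite: LangeBirkenhake1992, §5.3] -/
theorem complexBetti_map_biprodInr_prodPolarizationClass :
    complexBetti.map (biprod.inr ≫ (AbelianVariety.biprodIsoProd A B).hom).hom.hom.hom 2
      (prodPolarizationClass A B hA hB) = hB :=
  complexBetti_map_prodPolarizationClass_of_comp_snd_eq_id A B _
    (by rw [Category.assoc, AbelianVariety.biprodIsoProd_hom_fst, biprod.inr_fst])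
    (by rw [Category.assoc, AbelianVariety.biprodIsoProd_hom_snd, biprod.inr_snd])

/-- **`D = pr_A^* h_A + pr_B^* h_B` determines `h_A` and `h_B`.** [cite: LangeBirkenhake1992, §5.3]
[cite: Milne1999LefschetzClasses, §1 p. 643] -/
theorem prodPolarizationClass_inj {hA hA' : complexBetti A.X 2} {hB hB' : complexBetti B.X 2} :
    prodPolarizationClass A B hA hB = prodPolarizationClass A B hA' hB' ↔ hA = hA' ∧ hB = hB' := by
  refine ⟨fun h ↦ ⟨?_, ?_⟩, fun h ↦ by rw [h.1, h.2]⟩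
  · rw [← complexBetti_map_prodLift_id_zero_prodPolarizationClass A B (hA := hA) (hB := hB), h,
      complexBetti_map_prodLift_id_zero_prodPolarizationClass]
  · rw [← complexBetti_map_prodLift_zero_id_prodPolarizationClass A B (hA := hA) (hB := hB), h,
      complexBetti_map_prodLift_zero_id_prodPolarizationClass]

end Restriction

/-! ### §2 Transport along homomorphisms with a two-sided inverse -/

section Transport

variable {P Q : AbelianVariety ℂ} {f : P ⟶ Q} {g : Q ⟶ P}

/-- A homomorphism with a two-sided inverse is an isogeny. [cite: MumfordAV1970, §19] -/
private theorem isIsogeny_of_inverse (hfg : f ≫ g = 𝟙 P) (hgf : g ≫ f = 𝟙 Q) : AbelianVariety.IsIsogeny f :=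
  AbelianVariety.isIsogeny_of_comp_eq_of_comp_eq (h := g) (AbelianVariety.isIsogeny_id _)
    (AbelianVariety.isIsogeny_id _) hgf hfg

/-- **Along a homomorphism `f : P ⟶ Q` with a two-sided inverse, `f^* κ` is hard Lefschetz in dimension `dim P` iff
`κ` is hard Lefschetz in dimension `dim Q`** (`f^*` is an isomorphism on `H*`; `dim P = dim Q`).
[cite: vanGeemen1994HodgeAV, 3.6 (p. 236)] [cite: MumfordAV1970, §19] -/
theorem hasHardLefschetzProperty_map_iff_of_comp_eq_id (hfg : f ≫ g = 𝟙 P) (hgf : g ≫ f = 𝟙 Q)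
    (κ : complexBetti Q.X 2) :
    HasHardLefschetzProperty (complexBetti.map f.hom.hom.hom 2 κ) P.dim ↔ HasHardLefschetzProperty κ Q.dim := by
  rw [AbelianVariety.dim_eq_of_isIsogeny (isIsogeny_of_inverse hfg hgf)]
  exact Deligne1982.hasHardLefschetzProperty_map_iff_of_isIsogeny (isIsogeny_of_inverse hfg hgf) κ _

/-- **Along a homomorphism `f : P ⟶ Q` with a two-sided inverse, `f^* κ` is a polarization class of `P` iff `κ` is a
polarization class of `Q`** (both directions are pull-backs along isogenies, `IsPolarizationClass.map_of_isIsogeny'`,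
as `g^* f^* κ = κ`, the tree's `map_map_of_comp_eq_id`). [cite: LangeBirkenhake1992, Lemma 1.7.4 and §5.3] [cite: vanGeemen1994HodgeAV, 3.6 (p. 236)] -/
theorem isPolarizationClass_map_iff_of_comp_eq_id (hfg : f ≫ g = 𝟙 P) (hgf : g ≫ f = 𝟙 Q) (κ : complexBetti Q.X 2) :
    IsPolarizationClass P.dim P.X (complexBetti.map f.hom.hom.hom 2 κ) ↔ IsPolarizationClass Q.dim Q.X κ := by
  refine ⟨fun H ↦ ?_, fun H ↦ H.map_of_isIsogeny' (isIsogeny_of_inverse hfg hgf)⟩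
  have H' := H.map_of_isIsogeny' (isIsogeny_of_inverse hgf hfg)
  rwa [map_map_of_comp_eq_id hgf 2 κ] at H'

end Transport

/-! ### §3 `A × B`: `D` is hard Lefschetz / a polarization class iff `h_A` and `h_B` are -/

section Prod

variable (A B : AbelianVariety ℂ) {hA : complexBetti A.X 2} {hB : complexBetti B.X 2}

/-- **`D = pr_A^* h_A + pr_B^* h_B` is hard Lefschetz in dimension `dim (A × B)` iff `h_A` and `h_B` are hard Lefschetz
in dimensions `dim A`, `dim B`** (`HodgeTheory.hasHardLefschetzProperty_map_fst_add_map_snd_iff`: injectivity on a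
factor is tested inside the product, bijectivity by Poincaré duality). [cite: Milne1999LefschetzClasses, §1 p. 643]
[cite: HarimaEtAl2013, Thm. 3.34 and Prop. 3.67] -/
theorem hasHardLefschetzProperty_prodPolarizationClass_iff :
    HasHardLefschetzProperty (prodPolarizationClass A B hA hB) (A.prod B).dim ↔
      HasHardLefschetzProperty hA A.dim ∧ HasHardLefschetzProperty hB B.dim := by
  rw [AbelianVariety.dim_prod]
  exact hasHardLefschetzProperty_map_fst_add_map_snd_iff (AbelianVariety.isSmoothProjective_holds (A := A))
    (AbelianVariety.isSmoothProjective_holds (A := B))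

/-- **«`D = D_A × B + A × D_B` is an ample divisor on `A × B`» ⟺ on the carriers: `pr_A^* h_A + pr_B^* h_B` is a
polarization class of `A × B` iff `h_A`, `h_B` are polarization classes of `A`, `B`.**
[cite: Milne1999LefschetzClasses, §1 p. 643] [cite: LangeBirkenhake1992, §5.3] [cite: HarimaEtAl2013, Thm. 3.34 and Prop. 3.67] -/
theorem isPolarizationClass_prodPolarizationClass_iff :
    IsPolarizationClass (A.prod B).dim (A.prod B).X (prodPolarizationClass A B hA hB) ↔
      IsPolarizationClass A.dim A.X hA ∧ IsPolarizationClass B.dim B.X hB := by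
  rw [AbelianVariety.dim_prod]
  exact isPolarizationClass_map_fst_add_map_snd_iff (AbelianVariety.isSmoothProjective_holds (A := A))
    (AbelianVariety.isSmoothProjective_holds (A := B))

/-- If `pr_A^* h_A + pr_B^* h_B` is a polarization class of `A × B` then `h_A` is a polarization class of `A`.
[cite: LangeBirkenhake1992, §5.3] [cite: Milne1999LefschetzClasses, §1 p. 643] -/
theorem _root_.Literature.AlgebraicGeometry.HodgeTheory.IsPolarizationClass.left_of_prodPolarizationClass
    (hD : IsPolarizationClass (A.prod B).dim (A.prod B).X (prodPolarizationClass A B hA hB)) :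
    IsPolarizationClass A.dim A.X hA :=
  ((isPolarizationClass_prodPolarizationClass_iff A B).1 hD).1

/-- If `pr_A^* h_A + pr_B^* h_B` is a polarization class of `A × B` then `h_B` is a polarization class of `B`.
[cite: LangeBirkenhake1992, §5.3] [cite: Milne1999LefschetzClasses, §1 p. 643] -/
theorem _root_.Literature.AlgebraicGeometry.HodgeTheory.IsPolarizationClass.right_of_prodPolarizationClass
    (hD : IsPolarizationClass (A.prod B).dim (A.prod B).X (prodPolarizationClass A B hA hB)) :
    IsPolarizationClass B.dim B.X hB :=
  ((isPolarizationClass_prodPolarizationClass_iff A B).1 hD).2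

end Prod

/-! ### §4 `A^{r+1}`: `Σᵢ prᵢ^* h` is hard Lefschetz / a polarization class iff `h` is -/

section Pow

variable (A : AbelianVariety ℂ) {h : complexBetti A.X 2}

/-- **`h^{(r+1)} = Σᵢ prᵢ^* h` is hard Lefschetz in dimension `dim A^{r+1}` iff `h` is hard Lefschetz in dimension
`dim A`** (induction along `A^{r+2} = A^{r+1} × A`). [cite: Milne1999LefschetzClasses, §1 p. 643]
[cite: HarimaEtAl2013, Thm. 3.34 and Prop. 3.67] -/
theorem hasHardLefschetzProperty_powPolarizationClass_iff :
    ∀ r : ℕ, HasHardLefschetzProperty (powPolarizationClass A h r) (A.powSucc r).dim ↔ HasHardLefschetzProperty h A.dim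
  | 0 => Iff.rfl
  | r + 1 => by
    rw [powPolarizationClass_succ]
    exact (hasHardLefschetzProperty_prodPolarizationClass_iff _ _).trans
      ⟨fun H ↦ H.2, fun H ↦ ⟨(hasHardLefschetzProperty_powPolarizationClass_iff r).2 H, H⟩⟩

/-- **`Σᵢ prᵢ^* h` is a polarization class of `A^{r+1}` iff `h` is a polarization class of `A`.**
[cite: Milne1999LefschetzClasses, §1 p. 643] [cite: LangeBirkenhake1992, §5.3] -/
theorem isPolarizationClass_powPolarizationClass_iff :
    ∀ r : ℕ, IsPolarizationClass (A.powSucc r).dim (A.powSucc r).X (powPolarizationClass A h r) ↔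
      IsPolarizationClass A.dim A.X h
  | 0 => Iff.rfl
  | r + 1 => by
    rw [powPolarizationClass_succ]
    exact (isPolarizationClass_prodPolarizationClass_iff _ _).trans
      ⟨fun H ↦ H.2, fun H ↦ ⟨(isPolarizationClass_powPolarizationClass_iff r).2 H, H⟩⟩

end Pow

/-! ### §5 `⨁ᵢ Aᵢ`: `Σᵢ πᵢ^* hᵢ` is hard Lefschetz / a polarization class iff every `hᵢ` is -/

section Sum

/-- **`Σᵢ πᵢ^* hᵢ` is hard Lefschetz in dimension `dim ⨁ Aᵢ` iff every `hᵢ` is hard Lefschetz in dimension `dim Aᵢ`**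
(induction along the comparison isomorphism `⨁_{Fin (n+1)} A ≅ A 0 × ⨁_{Fin n} (A ∘ succ)`, §2–§3).
[cite: Milne1999LefschetzClasses, §1 p. 643] [cite: HarimaEtAl2013, Thm. 3.34 and Prop. 3.67] [cite: MumfordAV1970, §19] -/
theorem hasHardLefschetzProperty_sumPolarizationClass_iff : ∀ {n : ℕ} (A : Fin (n + 1) → AbelianVariety ℂ)
    (h : ∀ i, complexBetti (A i).X 2),
    HasHardLefschetzProperty (sumPolarizationClass A h) (⨁ A).dim ↔ ∀ i, HasHardLefschetzProperty (h i) (A i).dim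
  | 0, A, h => by
    rw [sumPolarizationClass_fin_one,
      hasHardLefschetzProperty_map_iff_of_comp_eq_id (biproduct_π_ι_fin_one A) (biproduct.ι_π_self A 0), Fin.forall_fin_one]
  | n + 1, A, h => by
    rw [← map_biproductSuccSplit_prodPolarizationClass,
      hasHardLefschetzProperty_map_iff_of_comp_eq_id (biproductSuccSplit_comp_inv A) (biproductSuccSplitInv_comp A),
      hasHardLefschetzProperty_prodPolarizationClass_iff,
      hasHardLefschetzProperty_sumPolarizationClass_iff (fun i : Fin (n + 1) => A i.succ) (fun i => h i.succ)]
    exact (Fin.forall_fin_succ (P := fun i => HasHardLefschetzProperty (h i) (A i).dim)).symm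

/-- **«`D = Σᵢ A₁ × ⋯ × Dᵢ × ⋯ × A_s` is an ample divisor on `A`» ⟺ on the carriers: `Σᵢ πᵢ^* hᵢ` is a polarization
class of `⨁_{i<n+1} Aᵢ` iff every `hᵢ` is a polarization class of `Aᵢ`.** [cite: Milne1999LefschetzClasses, §1 p. 643]
[cite: LangeBirkenhake1992, §5.3] [cite: MumfordAV1970, §19] -/
theorem isPolarizationClass_sumPolarizationClass_iff : ∀ {n : ℕ} (A : Fin (n + 1) → AbelianVariety ℂ)
    (h : ∀ i, complexBetti (A i).X 2),
    IsPolarizationClass (⨁ A).dim (⨁ A).X (sumPolarizationClass A h) ↔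
      ∀ i, IsPolarizationClass (A i).dim (A i).X (h i)
  | 0, A, h => by
    rw [sumPolarizationClass_fin_one,
      isPolarizationClass_map_iff_of_comp_eq_id (biproduct_π_ι_fin_one A) (biproduct.ι_π_self A 0), Fin.forall_fin_one]
  | n + 1, A, h => by
    rw [← map_biproductSuccSplit_prodPolarizationClass,
      isPolarizationClass_map_iff_of_comp_eq_id (biproductSuccSplit_comp_inv A) (biproductSuccSplitInv_comp A),
      isPolarizationClass_prodPolarizationClass_iff,
      isPolarizationClass_sumPolarizationClass_iff (fun i : Fin (n + 1) => A i.succ) (fun i => h i.succ)]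
    exact (Fin.forall_fin_succ (P := fun i => IsPolarizationClass (A i).dim (A i).X (h i))).symm

end Sum

end Literature.AlgebraicGeometry.Milne1999

end
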